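import Mathlib.LinearAlgebra.Dual.Lemmas
import Mathlib.LinearAlgebra.Finsupp.LinearCombination
import Mathlib.LinearAlgebra.Pi
import Mathlib.Algebra.Field.ZMod
import Mathlib.Algebra.CharP.Two
import Mathlib.Algebra.BigOperators.Pi
import Mathlib.Tactic.Abel
import Mathlib.Tactic.LinearCombination
import HarnessLib

/-!
# Route ConvexRankGates, crux `Capture` (stmt-PneNP-2659), line `csp-spine-meet-to-join` rev 4, Stub L1:
# two affine duality lemmas over `𝔽₂` (`stub_affineLemmas = AffineDual ∧ AffineComb`)

Theorem A of the line (coset CSPs over 2-groups with all squares central and exponent 4 are ONE abelian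
PERM gate) needs two pieces of linear algebra over the field `𝔽₂ = ZMod 2`:

* **AffineDual** (`al_affine_dual`). `S ⊆ 𝔽₂^ι` nonempty and closed under `x + y + w` (an affine
  subspace), `Ψ : 𝔽₂^ι → 𝔽₂^κ` affine on `S` (`Ψ (x+y+w) = Ψ x + Ψ y + Ψ w`) and nowhere zero on `S`.
  Then ONE functional `μ` has `∑ t, μ t * Ψ x t = 1` for every `x ∈ S`. Proof: fix `x₀ ∈ S`; the
  direction space `W = {Ψ x + Ψ x₀ | x ∈ S}` is a submodule (closure + affineness with `w = x₀`), the
  image `Ψ '' S = Ψ x₀ + W` misses `0`, so `Ψ x₀ ∉ W`; a functional separating `Ψ x₀` from `W`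
  (`Submodule.exists_dual_map_eq_bot_of_notMem`) is `1` on the whole coset.
* **AffineComb** (`al_affine_comb`). Affine forms `e v = (constant, coefficients)` on `𝔽₂^ι` with a
  common zero; an affine form `q` vanishing at every common zero is an `𝔽₂`-combination
  `q = ∑ v, cf v • e v` EXACTLY (as pairs). Proof (homogenised): if `q ∉ span (range e)`, a functional
  `g` on `𝔽₂ × 𝔽₂^ι` kills every `e v` but not `q`; in coordinates `g (a, u) = a * c₀ + u ⬝ y`.
  If `c₀ = 1`, `y` is a common zero at which `q` does not vanish; if `c₀ = 0`, `y` is a direction of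
  the common-zero set (`x₁ ↦ x₁ + y`) along which `q` changes — contradiction either way.
[folklore]
-/

namespace Summit.PneNP.PneNP.Cruxes.Capture.CspSpineMeetToJoin

set_option linter.dupNamespace false -- `Summit.PneNP.PneNP.…`: summit = sub-problem (D-0017)

/-- A linear functional on `κ → 𝔽₂` is a coordinate combination: `f v = ∑ t, μ t * v t`. [folklore] -/
theorem al_dual_pi {κ : Type} [Fintype κ] (f : Module.Dual (ZMod 2) (κ → ZMod 2)) :
    ∃ μ : κ → ZMod 2, ∀ v : κ → ZMod 2, f v = ∑ t, μ t * v t := by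
  classical
  refine ⟨fun t => f fun j => if t = j then 1 else 0, fun v => ?_⟩
  rw [LinearMap.pi_apply_eq_sum_univ f v]
  exact Finset.sum_congr rfl fun t _ => by rw [smul_eq_mul, mul_comm]

/-- A linear functional on `𝔽₂ × (ι → 𝔽₂)` in coordinates: `g (a, u) = a * c₀ + ∑ i, u i * y i`.
[folklore] -/
theorem al_dual_prod {ι : Type} [Fintype ι] (g : Module.Dual (ZMod 2) (ZMod 2 × (ι → ZMod 2))) :
    ∃ (c₀ : ZMod 2) (y : ι → ZMod 2), ∀ (a : ZMod 2) (u : ι → ZMod 2),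
      g (a, u) = a * c₀ + ∑ i, u i * y i := by
  classical
  obtain ⟨y, hy⟩ := al_dual_pi (g ∘ₗ LinearMap.inr (ZMod 2) (ZMod 2) (ι → ZMod 2))
  refine ⟨g (1, 0), y, fun a u => ?_⟩
  have h1 : ((a, u) : ZMod 2 × (ι → ZMod 2)) =
      a • ((1 : ZMod 2), (0 : ι → ZMod 2)) + LinearMap.inr (ZMod 2) (ZMod 2) (ι → ZMod 2) u := by
    ext <;> simp
  rw [h1, map_add, map_smul, smul_eq_mul, ← LinearMap.comp_apply (f := g), hy u]
  exact congrArg _ (Finset.sum_congr rfl fun i _ => mul_comm _ _)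

/-- **AffineDual** (binder form): a nowhere-zero affine map on a nonempty affine subspace of `𝔽₂^ι`
is sent to the constant `1` by one linear functional. [folklore] -/
theorem al_affine_dual {ι κ : Type} [Fintype ι] [Fintype κ] (S : Set (ι → ZMod 2)) (hS : S.Nonempty)
    (hS3 : ∀ x ∈ S, ∀ y ∈ S, ∀ w ∈ S, x + y + w ∈ S) (Ψ : (ι → ZMod 2) → κ → ZMod 2)
    (hΨ : ∀ x ∈ S, ∀ y ∈ S, ∀ w ∈ S, Ψ (x + y + w) = Ψ x + Ψ y + Ψ w) (hΨ0 : ∀ x ∈ S, Ψ x ≠ 0) :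
    ∃ μ : κ → ZMod 2, ∀ x ∈ S, ∑ t, μ t * Ψ x t = 1 := by
  classical
  have zmod2 : ∀ c : ZMod 2, c = 0 ∨ c = 1 := by decide
  have two : ∀ v : κ → ZMod 2, v + v = 0 := fun v => funext fun t => CharTwo.add_self_eq_zero (v t)
  obtain ⟨x₀, hx₀⟩ := hS
  -- the direction space of the image: `W = {Ψ x + Ψ x₀ | x ∈ S}` is a submodule
  let W : Submodule (ZMod 2) (κ → ZMod 2) := Submodule.span (ZMod 2) ((fun x => Ψ x + Ψ x₀) '' S)
  have hW : ∀ v ∈ W, ∃ x ∈ S, v = Ψ x + Ψ x₀ := by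
    intro v hv
    induction hv using Submodule.span_induction with
    | mem v hv =>
      obtain ⟨x, hx, rfl⟩ := hv
      exact ⟨x, hx, rfl⟩
    | zero => exact ⟨x₀, hx₀, (two _).symm⟩
    | add u v _ _ hu hv =>
      obtain ⟨x, hx, rfl⟩ := hu
      obtain ⟨y, hy, rfl⟩ := hv
      refine ⟨x + y + x₀, hS3 x hx y hy x₀ hx₀, ?_⟩
      rw [hΨ x hx y hy x₀ hx₀]
      abel
    | smul c v _ hv =>
      rcases zmod2 c with rfl | rfl
      · rw [zero_smul]
        exact ⟨x₀, hx₀, (two _).symm⟩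
      · rw [one_smul]
        exact hv
  -- `0 ∉ Ψ '' S = Ψ x₀ + W`, i.e. `Ψ x₀ ∉ W`
  have hx₀W : Ψ x₀ ∉ W := fun h => by
    obtain ⟨x, hx, hEq⟩ := hW _ h
    refine hΨ0 x hx ?_
    calc Ψ x = Ψ x + (Ψ x₀ + Ψ x₀) := by rw [two, add_zero]
      _ = Ψ x + Ψ x₀ + Ψ x₀ := (add_assoc _ _ _).symm
      _ = Ψ x₀ + Ψ x₀ := by rw [← hEq]
      _ = 0 := two _
  -- separate `Ψ x₀` from `W` by a linear functional
  haveI : Fact (Nat.Prime 2) := ⟨Nat.prime_two⟩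
  haveI : Module.Free (ZMod 2) ((κ → ZMod 2) ⧸ W) := Module.Free.of_divisionRing (ZMod 2) _
  obtain ⟨f, hf0, hfW⟩ := Submodule.exists_dual_map_eq_bot_of_notMem hx₀W Module.Projective.of_free
  have hfW' : ∀ v ∈ W, f v = 0 := fun v hv => by
    have : f v ∈ W.map f := Submodule.mem_map_of_mem hv
    rwa [hfW, Submodule.mem_bot] at this
  have hf1 : f (Ψ x₀) = 1 := by
    rcases zmod2 (f (Ψ x₀)) with h | h
    · exact absurd h hf0
    · exact h
  obtain ⟨μ, hμ⟩ := al_dual_pi f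
  refine ⟨μ, fun x hx => ?_⟩
  have hmem : Ψ x + Ψ x₀ ∈ W := Submodule.subset_span ⟨x, hx, rfl⟩
  calc ∑ t, μ t * Ψ x t = f (Ψ x) := (hμ (Ψ x)).symm
    _ = f (Ψ x + Ψ x₀ + Ψ x₀) := by rw [add_assoc, two, add_zero]
    _ = f (Ψ x + Ψ x₀) + f (Ψ x₀) := map_add f _ _
    _ = 1 := by rw [hfW' _ hmem, hf1, zero_add]

/-- **AffineComb** (binder form, affine Nullstellensatz in degree one over `𝔽₂`): an affine form
vanishing on the nonempty common-zero set of the affine forms `e v` is `∑ v, cf v • e v`. [folklore] -/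
theorem al_affine_comb {ι V : Type} [Fintype ι] [Fintype V] (e : V → ZMod 2 × (ι → ZMod 2))
    (q : ZMod 2 × (ι → ZMod 2)) (hex : ∃ x : ι → ZMod 2, ∀ v, (e v).1 + ∑ i, (e v).2 i * x i = 0)
    (hq : ∀ x : ι → ZMod 2, (∀ v, (e v).1 + ∑ i, (e v).2 i * x i = 0) →
      q.1 + ∑ i, q.2 i * x i = 0) :
    ∃ cf : V → ZMod 2, q = ∑ v, cf v • e v := by
  classical
  have zmod2 : ∀ c : ZMod 2, c = 0 ∨ c = 1 := by decide
  by_contra hne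
  have hq' : q ∉ Submodule.span (ZMod 2) (Set.range e) := fun hmem => by
    obtain ⟨c, hc⟩ := (Submodule.mem_span_range_iff_exists_fun (ZMod 2)).1 hmem
    exact hne ⟨c, hc.symm⟩
  haveI : Fact (Nat.Prime 2) := ⟨Nat.prime_two⟩
  haveI : Module.Free (ZMod 2) ((ZMod 2 × (ι → ZMod 2)) ⧸ Submodule.span (ZMod 2) (Set.range e)) :=
    Module.Free.of_divisionRing (ZMod 2) _
  obtain ⟨g, hgq, hgW⟩ := Submodule.exists_dual_map_eq_bot_of_notMem hq' Module.Projective.of_free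
  have hge : ∀ v, g (e v) = 0 := fun v => by
    have : g (e v) ∈ (Submodule.span (ZMod 2) (Set.range e)).map g :=
      Submodule.mem_map_of_mem (Submodule.subset_span ⟨v, rfl⟩)
    rwa [hgW, Submodule.mem_bot] at this
  -- coordinates of `g`
  obtain ⟨c₀, y, hg⟩ := al_dual_prod g
  have hg' : ∀ z : ZMod 2 × (ι → ZMod 2), g z = z.1 * c₀ + ∑ i, z.2 i * y i := fun z => hg z.1 z.2
  obtain ⟨x₁, hx₁⟩ := hex
  rcases zmod2 c₀ with h0 | h1
  · -- `c₀ = 0`: `y` is a direction of the common-zero set along which `q` changes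
    have hy0 : ∀ v, ∑ i, (e v).2 i * y i = 0 := fun v => by
      have := hge v
      rwa [hg', h0, mul_zero, zero_add] at this
    have hsol : ∀ v, (e v).1 + ∑ i, (e v).2 i * (x₁ + y) i = 0 := fun v => by
      simp only [Pi.add_apply, mul_add, Finset.sum_add_distrib]
      rw [hy0 v, add_zero]
      exact hx₁ v
    have h₁ := hq x₁ hx₁
    have h₂ := hq (x₁ + y) hsol
    simp only [Pi.add_apply, mul_add, Finset.sum_add_distrib] at h₂
    refine hgq ?_
    rw [hg', h0, mul_zero, zero_add]
    linear_combination h₂ - h₁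
  · -- `c₀ = 1`: `y` is a common zero at which `q` does not vanish
    have hsol : ∀ v, (e v).1 + ∑ i, (e v).2 i * y i = 0 := fun v => by
      have := hge v
      rwa [hg', h1, mul_one] at this
    refine hgq ?_
    rw [hg', h1, mul_one]
    exact hq y hsol

/-- **Stub L1 — `AffineDual ∧ AffineComb`** (registered sub-goal `stub_affineLemmas` of stmt-PneNP-2659,
line `csp-spine-meet-to-join` rev 4, stated as one closed proposition): the two affine duality lemmas
over `𝔽₂`, see `al_affine_dual` and `al_affine_comb`. [folklore] -/
theorem stub_affineLemmas :
    (∀ (ι κ : Type) [Fintype ι] [Fintype κ] (S : Set (ι → ZMod 2)),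
      S.Nonempty → (∀ x ∈ S, ∀ y ∈ S, ∀ w ∈ S, x + y + w ∈ S) →
      ∀ (Ψ : (ι → ZMod 2) → κ → ZMod 2),
        (∀ x ∈ S, ∀ y ∈ S, ∀ w ∈ S, Ψ (x + y + w) = Ψ x + Ψ y + Ψ w) →
        (∀ x ∈ S, Ψ x ≠ 0) →
        ∃ μ : κ → ZMod 2, ∀ x ∈ S, ∑ t, μ t * Ψ x t = 1) ∧
    (∀ (ι V : Type) [Fintype ι] [Fintype V]
      (e : V → ZMod 2 × (ι → ZMod 2)) (q : ZMod 2 × (ι → ZMod 2)),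
      (∃ x : ι → ZMod 2, ∀ v, (e v).1 + ∑ i, (e v).2 i * x i = 0) →
      (∀ x : ι → ZMod 2, (∀ v, (e v).1 + ∑ i, (e v).2 i * x i = 0) → q.1 + ∑ i, q.2 i * x i = 0) →
      ∃ cf : V → ZMod 2, q = ∑ v, cf v • e v) := by
  exact ⟨fun _ _ _ _ S hS hS3 Ψ hΨ hΨ0 => al_affine_dual S hS hS3 Ψ hΨ hΨ0,
    fun _ _ _ _ e q hex hq => al_affine_comb e q hex hq⟩

end Summit.PneNP.PneNP.Cruxes.Capture.CspSpineMeetToJoin
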